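import Summits.BirchSwinnertonDyer.Rank1Residual.X2.GreenbergVatsalCaseTwo
import Summits.BirchSwinnertonDyer.Rank1Residual.X2.RankZero
import Literature.NumberTheory.EllipticCurves.GreenbergVatsal2000.ResidualLifting
import Literature.NumberTheory.EllipticCurves.GreenbergVatsal2000.EisensteinCongruenceResidual
import HarnessLib

/-!
# The flag facts A63/A64 (`GV00-mult-asserted`) from REGISTERED LITERATURE FACTS ONLY: the two
# typed GV inputs of gen 17 are (definitionally) the Literature reading-facts
# `residualEpsilon_surjOn_of_lineRamifiedEven` (GV p. 28/30) and
# `nonPrimitive_unitContent_and_lambda_eq_residual_of_lineRamifiedEven` (GV Thm. (3.11) + (28) + p. 43)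
# (cell `b2b-bsdres`, unit `b2b-bsdres-eisenstein-p2`, gen 18)

HONEST FRAMING (run/shared/lean/b2b/bsd-rank1-residual/, verbatim in every file): the goal of the
cell is to DELETE the COMBINATION-SHAPED residual classes of the Birch–Swinnerton-Dyer formula for
ALL analytic-rank `≤ 1` elliptic curves over `ℚ` — "full BSD formula for every rank `≤ 1` curve in
class `C`" assembled STRICTLY from published theorems — so that the rank-`≤ 1` remainder becomes
exactly the CONSTRUCTION-SHAPED classes, which are TYPED (missing-input `Prop`s), NOT attempted.
This is not "finishing BSD". Research route; NO CLAIM BEYOND STATED CLASSES; nothing here changes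
a label (the seat proposes, the referee rules). Theorems only; no definition, no new named fact in
THIS file (the two reading-facts are filed under `Literature/…/GreenbergVatsal2000/`).

WHAT (X2-GAP §22.7 (L1), §23). The Literature file `GreenbergVatsal2000/ResidualSelmerGroups.lean`
twins the gen-16 residual vocabulary with IDENTICAL bodies (`StableSubgroup`, `residualLine` =
`lineSub`, `unramifiedSelmer` = `quotSelmer`, `pushH1` = `subH1`), so the two reading-facts filed on
it are DEFINITIONALLY the hypotheses `hLift`/`hAn` of `X2.caseOne_clause_of_inputs`:

* `gvLiftingInput_of_fact`: `residualEpsilon_surjOn_of_lineRamifiedEven → X2.GVLiftingInput …` (by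
  `exact`, definitional unfolding);
* `gvAnalyticInput_of_fact`: `nonPrimitive_unitContent_and_lambda_eq_residual_of_lineRamifiedEven →
  X2.GVAnalyticInput …` (idem);
* **`lambda_muAnal_multiplicative_of_gvPar_of_facts`**: A64 (= the content of the flag
  `GV00-mult-asserted`) from the registered facts A40/A41 (Tate uniformisation), A133, A135, A137
  (GV §1–§2 at `p ‖ N`), Greenberg 1999 Prop. 5.10, GV Cor. (3.8) (`IsogenyClassPeriod`), and the
  two reading-facts above — i.e. from NUMBERED / PRINTED Literature statements only, both parity
  cases (gen 17 CASE 1 + gen 18 CASE 2, `X2/GreenbergVatsalCaseTwo`);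
* **`lambdaMu_multiplicative_of_gvPar_of_facts`**: A63 likewise (+ Wuthrich 2014 Thm. 16);
* `targetA_of_facts`: the X2a closure of record `X2.RankZero.targetA_of_published` fed with the
  derived A63 — `X2.TargetA` from registered Literature facts.

References: [GreenbergVatsal2000] Thm. (1.3), §2 pp. 28–30, display (16), §3 Thm. (3.11), (28),
p. 43, Cor. (3.8); [GreenbergLNM1716] Prop. 5.10; [Wuthrich2014] Thm. 16;
HOME/b2b-bsdres-eisenstein-p2/X2-GAP.md §23.
-/

set_option autoImplicit false

noncomputable section

open scoped Classical AddSubgroup MatrixGroups ModularForm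

open PowerSeries NumberField IsDedekindDomain Field WeierstrassCurve CongruenceSubgroup
  Literature.NumberTheory.EllipticCurves Literature.NumberTheory.EllipticCurves.GreenbergVatsal2000
  Literature.NumberTheory.EllipticCurves.ModularForms
  Literature.NumberTheory.EllipticCurves.Wuthrich2014
  Literature.NumberTheory.EllipticCurves.SteinWuthrich2013
  Literature.NumberTheory.EllipticCurves.Rank1Residual
  Summit.BirchSwinnertonDyer.Rank1Residual.X2.GreenbergVatsalCaseTwo

namespace Summit.BirchSwinnertonDyer.Rank1Residual.X2.GreenbergVatsalInputsOfFacts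

/-- **The typed lifting input IS the Literature reading-fact GV p. 28/30** (definitional: the
Literature twins `residualQuotSelmer`, `residualTorsionH1`, `residualEpsilon` unfold to gen 16's
`quotSelmer … (lineSub Φ₀ hΦ).Quot …`, `unramifiedOutside … E[p^∞][p] …`, `subH1 … (lineSub Φ₀ hΦ).proj …`).
[cite: GreenbergVatsal2000, §2 p. 28 with p. 30] -/
theorem gvLiftingInput_of_fact (h : residualEpsilon_surjOn_of_lineRamifiedEven)
    (W : WeierstrassCurve ℚ) [W.IsGloballyMinimal] [W.IsElliptic] (p : ℕ) [Fact p.Prime]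
    (κ : ZpExtension ℚ p) (S₀ : Finset (HeightOneSpectrum (𝓞 ℚ)))
    (Φ₀ : AddSubgroup (W.geomTorsion (p : ℤ))) (hΦ : IsRationalLine W p Φ₀)
    (hp : p ≠ 2) (hκ : κ.IsCyclotomic) (hram : ¬ LineUnramifiedAt W p Φ₀) (heven : LineEven W p Φ₀)
    (hS₀ : ∀ v ∈ S₀, ((p : ℕ) : 𝓞 ℚ) ∉ v.asIdeal)
    (hS : ∀ v : HeightOneSpectrum (𝓞 ℚ), v ∉ S₀ → ((p : ℕ) : 𝓞 ℚ) ∉ v.asIdeal →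
      W.HasGoodReductionAt v) :
    GVLiftingInput W p κ S₀ Φ₀ hΦ :=
  h W p κ S₀ Φ₀ hΦ hp hκ hram heven hS₀ hS

/-- **The typed analytic input IS the Literature reading-fact GV Thm. (3.11) + (28) + p. 43**
(definitional: `residualLineH1`/`residualQuotSelmer` unfold to gen 16's
`unramifiedOutside … (lineSub Φ₀ hΦ).Sub …`/`quotSelmer … (lineSub Φ₀ hΦ).Quot …`).
[cite: GreenbergVatsal2000, §3 Thm. (3.11), (28), p. 43] -/
theorem gvAnalyticInput_of_fact (h : nonPrimitive_unitContent_and_lambda_eq_residual_of_lineRamifiedEven)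
    (W : WeierstrassCurve ℚ) [W.IsGloballyMinimal] [W.IsElliptic] (p : ℕ) [Fact p.Prime]
    (κ : ZpExtension ℚ p) {N : ℕ} [NeZero N] (f : CuspForm (Gamma0 N) 2)
    (S₀ : Finset (HeightOneSpectrum (𝓞 ℚ)))
    (Φ₀ : AddSubgroup (W.geomTorsion (p : ℤ))) (hΦ : IsRationalLine W p Φ₀)
    (hp : p ≠ 2) (hmult : W.HasMultiplicativeReductionAtPrime p) (hκ : κ.IsCyclotomic)
    (hram : ¬ LineUnramifiedAt W p Φ₀) (heven : LineEven W p Φ₀) (hf : IsNewformOf W f)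
    (hS₀ : ∀ v ∈ S₀, ((p : ℕ) : 𝓞 ℚ) ∉ v.asIdeal)
    (hS : ∀ v : HeightOneSpectrum (𝓞 ℚ), v ∉ S₀ → ((p : ℕ) : 𝓞 ℚ) ∉ v.asIdeal →
      W.HasGoodReductionAt v) :
    GVAnalyticInput W p κ f S₀ Φ₀ hΦ :=
  h W p κ f S₀ Φ₀ hΦ hp hmult hκ hram heven hf hS₀ hS

/-- **A64 = `GreenbergVatsal2000.lambda_muAnal_multiplicative_of_gvPar` (the exact content of the
cell's flag `GV00-mult-asserted`) FROM REGISTERED LITERATURE FACTS**: Tate uniformisation A40/A41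
(`hT`, `hT'`), GV §1–§2 at `p ‖ N` A133 (`hA`), A135 (`hB`), A137 (`hF`), Greenberg 1999 Prop. 5.10
(`hG`), the two GV reading-facts p. 28/30 (`hLiftF`) and Thm. (3.11)+(28)+p. 43 (`hAnF`), and GV
Cor. (3.8) (`hP`) — via gen 17's CASE 1 and gen 18's CASE 2 (`lambda_muAnal_multiplicative_of_gvPar_of_inputs`).
[cite: GreenbergVatsal2000, Thm. (1.3), §2 (16), pp. 28–30, §3 Thm. (3.11), (28), p. 43, Cor. (3.8)]
[cite: GreenbergLNM1716, Prop. 5.10 (PDF p. 147)] -/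
theorem lambda_muAnal_multiplicative_of_gvPar_of_facts
    (hT : Silverman1994_thmV53_tateUniformisation.{0})
    (hT' : Silverman1994_thmV53_corV54_tateUniformisation.{0})
    (hA : lambda_nonPrimitive_eq_add_sum_delta_multiplicative)
    (hB : datumSelmer_divisible_of_finite_torsionBy)
    (hF : datumStrictSelmer_lt_datumSelmer_of_split)
    (hG : Greenberg1999.prop510_isTorsion_hasUnitContent_of_gvPar)
    (hLiftF : residualEpsilon_surjOn_of_lineRamifiedEven)
    (hAnF : nonPrimitive_unitContent_and_lambda_eq_residual_of_lineRamifiedEven)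
    (hP : cor38_realPeriodRat_eq_unit_mul_of_isIsogenous_of_gvPar) :
    lambda_muAnal_multiplicative_of_gvPar :=
  lambda_muAnal_multiplicative_of_gvPar_of_inputs hT hT' hA hB hF hG
    (fun W _ _ p _ κ S₀ Φ₀ hΦ hp hκ hram heven hS₀ hS ↦
      gvLiftingInput_of_fact hLiftF W p κ S₀ Φ₀ hΦ hp hκ hram heven hS₀ hS)
    (fun W _ _ p _ κ _ _ f S₀ Φ₀ hΦ hp hmult hκ hram heven hf hS₀ hS ↦
      gvAnalyticInput_of_fact hAnF W p κ f S₀ Φ₀ hΦ hp hmult hκ hram heven hf hS₀ hS)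
    hP

/-- **A63 = `GreenbergVatsal2000.lambdaMu_multiplicative_of_gvPar` (the monolithic GV-at-`p ‖ N`
fact consumed by the X2a closure of record and the X2c GVPar levers) FROM REGISTERED LITERATURE
FACTS** (those of `lambda_muAnal_multiplicative_of_gvPar_of_facts` + Wuthrich 2014 Thm. 16 `hWu`).
[cite: GreenbergVatsal2000, Thm. (1.3), §2 (16), pp. 28–30, §3 Thm. (3.11), (28), p. 43, Cor. (3.8)]
[cite: Wuthrich2014, Thm. 16 (p. 397)] [cite: GreenbergLNM1716, Prop. 5.10 (PDF p. 147)] -/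
theorem lambdaMu_multiplicative_of_gvPar_of_facts
    (hT : Silverman1994_thmV53_tateUniformisation.{0})
    (hT' : Silverman1994_thmV53_corV54_tateUniformisation.{0})
    (hA : lambda_nonPrimitive_eq_add_sum_delta_multiplicative)
    (hB : datumSelmer_divisible_of_finite_torsionBy)
    (hF : datumStrictSelmer_lt_datumSelmer_of_split)
    (hG : Greenberg1999.prop510_isTorsion_hasUnitContent_of_gvPar)
    (hLiftF : residualEpsilon_surjOn_of_lineRamifiedEven)
    (hAnF : nonPrimitive_unitContent_and_lambda_eq_residual_of_lineRamifiedEven)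
    (hP : cor38_realPeriodRat_eq_unit_mul_of_isIsogenous_of_gvPar)
    (hWu : thm16_charIdeal_dvd_multiplicative_of_reducible) :
    lambdaMu_multiplicative_of_gvPar :=
  lambdaMu_multiplicative_of_gvPar_of_parts hWu hG
    (lambda_muAnal_multiplicative_of_gvPar_of_facts hT hT' hA hB hF hG hLiftF hAnF hP)

/-- **`X2.TargetA` from registered Literature facts**: the X2a closure of record
`X2.RankZero.targetA_of_published` fed with the derived A63. Binders: the facts above + Stein–Wuthrich
2013 Thm. 6.1 (`hJs`/`hJn`), height existence (`hHs`/`hHn`), Gross–Zagier–Kolyvagin (`hGZK`),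
modularity (`hmod`, `hpar`), Greenberg–Stevens (`hGS`). [cite: GreenbergVatsal2000, Thm. (1.3) with pp. 1, 14–15]
[cite: Wuthrich2014, Thm. 16 (p. 397)] [cite: SteinWuthrich2013, Thm. 6.1 (p. 20)] -/
theorem targetA_of_facts
    (hT : Silverman1994_thmV53_tateUniformisation.{0})
    (hT' : Silverman1994_thmV53_corV54_tateUniformisation.{0})
    (hA : lambda_nonPrimitive_eq_add_sum_delta_multiplicative)
    (hB : datumSelmer_divisible_of_finite_torsionBy)
    (hF : datumStrictSelmer_lt_datumSelmer_of_split)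
    (hG : Greenberg1999.prop510_isTorsion_hasUnitContent_of_gvPar)
    (hLiftF : residualEpsilon_surjOn_of_lineRamifiedEven)
    (hAnF : nonPrimitive_unitContent_and_lambda_eq_residual_of_lineRamifiedEven)
    (hP : cor38_realPeriodRat_eq_unit_mul_of_isIsogenous_of_gvPar)
    (hWu : thm16_charIdeal_dvd_multiplicative_of_reducible)
    (hJs : thm61_splitMultiplicative) (hJn : thm61_nonsplitMultiplicative)
    (hHs : exists_isSplitMultCanonical) (hHn : exists_isMultCanonical)
    (hGZK : rank_eq_analyticRank_of_analyticRank_le_one) (hmod : hasEntireLFunction_rat)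
    (hpar : nonempty_modularParametrizationData)
    (hGS : ∀ (W : WeierstrassCurve ℚ) [W.IsElliptic] [W.IsGloballyMinimal] (p : ℕ) [Fact p.Prime],
      greenberg_stevens (W := W) (p := p)) :
    TargetA :=
  targetA_of_published
    (lambdaMu_multiplicative_of_gvPar_of_facts hT hT' hA hB hF hG hLiftF hAnF hP hWu)
    hWu hJs hJn hHs hHn hGZK hmod hpar hGS

end Summit.BirchSwinnertonDyer.Rank1Residual.X2.GreenbergVatsalInputsOfFacts

end
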